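import Literature.MathematicalPhysics.QuantumFieldTheory.Balaban1983to89.B9Eq349FlatQGGQInvKernel
import Literature.MathematicalPhysics.QuantumFieldTheory.Balaban1983to89.B9Eq349KernelConvolutionDecay

/-!
# `Balaban1983to89.B9Eq349FlatDPBlockDecay` — T. Bałaban, *Propagators for lattice gauge theories in a background field*, Commun. Math. Phys. **99** (1985)
# 389–434 [Balaban1985BackgroundPropagators] (3.49) p. 399 («|(DP)_μ(x,x′)| … ≤ O(1)e^{−δ₀d(y,y′)} for x ∈ Δ(y), x′ ∈ Δ(y′)») AT THE FLAT BACKGROUND `U ≡ 1`, with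
# (3.25) p. 394, [Balaban1984PropagatorsI] (1.44)–(1.45), (1.126) and [Balaban1983RegularityDecay] Lemma 2.4 (2.35): **ROW L9's BLOCK-DECAY LETTER `hτ` FOR
# `T(1) = D_1(1 − R(1))` FROM THE FLAT KERNELS — `‖1_{Δ(y₁)} ∘ D_1(1 − R(1)) ∘ 1_{Δ(y₀)}‖ ≤ C_τ⁰·e^{−r·d_m(y₀,y₁)}` for EVERY rate `r` below the cell's flat strip
# rate `κ₀`, with `C_τ⁰ = √(d+1)·L^{d+1}·K_AK_cK_B·K_{d+1}(κ₀ − r)²` built from the three kernel letters — THE RATE IS κ₁-FREE** — route R2′ STEP B8′ of the pub-balaban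
# NE9 chain, road B8″ (t4-ne9-idea-1 gen 100, `t4/ROUTES-NE9.md` v13.37 ADDENDUM (ii): «`hτ(U ≡ 1; C_τ⁰, σ′)` … κ₁ LEAVES THE RATE's CURRENCY»), the ASSEMBLY of S1∕S2

statement-level skeleton of published theorems with citation tags; proofs where landed; nothing here is a claim about the Yang–Mills mass gap

CITATION HEADER (lean-in-tree rule).  Audit cell `pub-balaban`, sub-cell `t4`, BINDER row NE9; filed by NE9 formalisation-swarm LEAF PROVER 06
(`b2b-balaban-t4-ne9-formalise-leaf-06`, gen 68) as the assembly of its gen-68 files: the kernel∕block junction `B9Eq349BlockDecayFromKernel` +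
`B9Eq349KernelConvolutionDecay` (`block_decay_of_conv3_kernel`) and the flat dictionary `B9Eq349FlatDGQKernel` (`A = D_1G′(1)Q̃′†`), `B9Eq349FlatQGKernel`
(`B = Q̃′G′(1)`), `B9Eq349FlatQGGQInvKernel` (`c = (Q̃′G′(1)²Q̃′†)⁻¹`), over this lineage's (3.25) formula `B9Eq325ProjFormula.RofU_eq_formula_one` (gen 58) and the
cells' torus decays ([B4] (2.48): `B4Torus248Decay`; [B5′] (1.45): `B5Torus145Decay`) whose bounds enter as DISPLAYED LETTERS `hbA`, `hbc` (their `∃`-packages are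
`B9Eq349FlatDGQKernel.exists_flatA_bound` ∕ `B9Eq349FlatQGGQInvKernel.exists_flatc_bound`).  CONSUMER: ne9-leaf-01's `B9Eq349KWAssembly.norm_sum_adad_le_lattice`
(p360108 ✓), whose `hτ` hypothesis the conclusion matches binder for binder at dimension `d+1` — the SECOND supplier of row L9's letter beside (K3)
`B9Eq349ConjugatedDPBlockDecay` (conjugation dress, rate `r = O(√κ₁)`); here the rate is any `r < κ₀`, `κ₀` the cell's flat strip letter (`d, a₋, a₊` only).
Sources READ: [Balaban1985BackgroundPropagators] pp. 394, 399 in the held text (`paper:balaban1985-cmp99-background-propagators`); [B5′] pp. 25–26, 38 and [B4]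
p. 582 through the cell's audited headers.

THE PRINT (verbatim).  [B9] p. 399 (3.49): *«… ≤ O(1)e^{−δ₀d(y,y′)}‖f‖ for x ∈ Δ(y), supp f ⊂ Δ(y′)»*; p. 415: *«These operators have random walk expansions … by the
method of [proof of (2.35) in] [13]»*; [B5′] p. 38: *«They follow from the representation P = G′Q′*(Q′G′²Q′*)⁻¹Q′G′, from Lemma 2.4 of [2], and the representation
(1.45) and the analyticity method of proving an exponential decay»*.  This file composes the cell's kernel-checked versions of exactly those three inputs at
`U ≡ 1`; print's `δ₀` is NOT valued — the rate is the cell's crude `κ₀`.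

WHAT IS PROVED (sorry-free; proof lane — no `def`; [folklore] composition on landed theorems; dimension `d+1` as J-M-α ∕ b04).  Letters: `ρ = (ηL)²c₁∕(c₀L^{d+1})`,
`a = a′ρ`, `σ = (c₀∕c₁)ρ²L^{d+1}`; `T(1)` = the operator of (K3)∕(K4b) `exists_block_decay_DP`∕`exists_kW_DP` at `U := 1`; the auxiliary `a′ > 0`, `c₁ > 0` parametrise
the (3.25) decomposition (`R(1)` itself is `a′`-free — [B5′] p. 26 «R … is of course by definition independent of a»).
* §1 **`equiv_flatT_apply`** — THE KERNEL OF `T(1)`: `(T(1)f)(b) = Σ_x k(b,x)•f(x)`, `k(b,x) = Σ_{y,y′} A(b,y)·c(y,y′)·B(y′,x)` with the three flat kernels of the prequels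
  (`RofU_eq_formula_one`: `(1 − R(1))f = G′Q̃′†(c(Q̃′G′f))`; then `equiv_D_GpQadj_one_apply`, `equiv_greenK_QGGQ_one_apply`, `equiv_QGp_one_apply`; two `Finset.sum_comm`).
* §2 **`flat_block_decay`** — ROW L9's `hτ` AT `U ≡ 1`: given b04's torus bound `hbA : ‖torusKernel248 L a 0 τ m v‖ ≤ M_A·e^{−κ₀|v|_{T,∞}}` and pv17's
  `hbc : ‖torusKernel145M L a m v‖ ≤ M_c·e^{−κ₀|v|_{T,∞}}` (displayed letters; `0 < κ₀`) and any `0 ≤ r < κ₀`: for ALL block families `P^S`, `P^B` and all `y₀, y₁`,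
  `‖P^B_{y₁} ∘L T(1) ∘L P^S_{y₀}‖ ≤ √(d+1)·L^{d+1}·(K_A·K_c·K_B·K_{d+1}(κ₀ − r)²)·e^{−(r·d_m(y₀,y₁))}`, `K_A = ‖η⁻¹‖ρM_A(e^{κ₀}+1)`, `K_c = σ⁻¹M_c`, `K_B = (c₀∕c₁)ρM_A`
  (`block_decay_of_conv3_kernel` on §1 with `norm_flatA_le` ∕ `norm_flatc_le` ∕ `norm_flatB_le`).
* §3 **`exists_flat_block_decay`** — THE PACKAGE: `∃ r > 0, C ≥ 0` with that `hτ`, `hbA`∕`hbc` DISCHARGED by `B4Torus248Decay.kernel248_torusKernel_decay_torusMetric` and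
  `B5Torus145Decay.inverse145_torusKernelM_decay_torusMetric` at `a′ := 1`, `c₁ := c₀` (`r` = half the smaller strip letter over `d+1`, a function of `(d, ρ)` only;
  `C` = §2's formula; the VOLUME `N` is quantified INSIDE the `∃` — uniform in the volume AS A TYPE, one storey stronger than (K3)∕(K4b)'s convention).
HONEST SCOPE.  Flat background ONLY (`U ≡ 1`): this is road B8″'s S1∕S2 («`hτ` at `U ≡ 1`»), NOT S3 (the ε_U-window by a conjugated Neumann series) and NOT §5's
supplier swap S4; the rate `r < κ₀` is κ₁-FREE but UNVALUED (the cell's `∃ κ` from `B4StripSums`∕`B5Strip145Leaves`; lens-1's `σ_Z = 0.9418` would sharpen `κ₀`, not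
claimed); the constant is crude (Hilbert–Schmidt on blocks, two full torus sums, `η⁻¹` from the difference quotient) and carries `η⁻¹`, `ρ`, `σ⁻¹`, `L^{d+1}` — finite
at every `(L, η)`, VOLUME-free, `U`-free; nothing of print's `δ₀`∕`O(1)` is asserted.  NOT NE9 (cell pub-balaban: NE9 NOT PRINTED ∕ NOT PROVED; «NE9 ⇐ the named binders»;
row WALLED ON A MODEL (O-NE9-1; #5 UNRULED); spine PROVED 0∕9; rung (B)+1 on a finite T⁴ — NOT infinite volume, NOT mass gap, NOT Clay; HONEST DEPENDENCY: continuum YM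
on T⁴ ⇐ BetaPertH ∧ nine spine estimates (0/9 proved); BetaPertH ⇐ (D1) ∧ (D4) ∧ CAP+tail; G-an2-4 gates asym, D1 and NE2/3/4).  NEW file importing
`B9Eq349FlatQGGQInvKernel` and `B9Eq349KernelConvolutionDecay` (this seat); nothing modified.  Net new unproved facts: 0.
-/

noncomputable section

set_option autoImplicit false

open scoped BigOperators InnerProductSpace ComplexConjugate

namespace Literature.MathematicalPhysics.QuantumFieldTheory.Balaban1983to89.B9Eq349FlatDPBlockDecay

open B4Sect5Torus (TSite tdist)
open B4TorusKernel (periodConst)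
open B4Sect5Proof (latticeConst latticeConst_nonneg)
open B9SectCLatticeCarrier (Bond bpos btgt)
open B9Eq311L2Pairing (WL2)
open B9Eq319QprimeTorus (fineP blockCoord)
open B11Eq103H1Complex (SiteL2K BondL2K covDerivL2K greenK)
open B9Eq310HessianOperator (adTransportW)
open B9Eq326OperatorAssembly (QprimeW RofU)
open B9Eq3119DeltaPiCarrier (laplacePrimeA GpOfU)
open B9Thm311DeltaPrimeA (laplacePrimeA_one_pos)
open B9Eq325ProjFormula (QGGQ_pos_one RofU_eq_formula_one)
open B9Eq315QTorusOnto (liftSite)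
open B4Torus248Decay (torusKernel248 kernel248_torusKernel_decay_torusMetric)
open B4TorusKernel.MultiPeriod (torusSupNorm torusSupNorm_nonneg)
open B4TorusGreen244 (KT)
open B5Torus145Decay (torusKernel145M inverse145_torusKernelM_decay_torusMetric)
open B9Eq365QGGQFlatCarrierDictionary (one_le_period)
open B9Eq349FlatDGQKernel (equiv_D_GpQadj_one_apply norm_flatA_le)
open B9Eq349FlatQGKernel (equiv_QGp_one_apply norm_flatB_le)
open B9Eq349FlatQGGQInvKernel (equiv_greenK_QGGQ_one_apply norm_flatc_le)
open B9Eq349KernelConvolutionDecay (block_decay_of_conv3_kernel)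

variable {d : ℕ} (L : ℕ) [NeZero L] (m : Fin (d + 1) → ℕ) [∀ i, NeZero (m i)] [∀ i, NeZero (fineP L m i)]
  {𝔸 : Type*} [Ring 𝔸] [Algebra ℂ 𝔸] {W : Type*} [NormedAddCommGroup W] [InnerProductSpace ℂ W] [FiniteDimensional ℂ W]
  (φ : W ≃ₗ[ℂ] 𝔸) (c₀ : ℝ) [Fact (0 < c₀)] (η : ℝ) (c₁ : ℝ) [Fact (0 < c₁)] (a' : ℝ) (hη : η ≠ 0) (ha : 0 < a')

/-! ## §1 The kernel of the flat `T(1) = D_1(1 − R(1))` is the triple coarse convolution `A∗c∗B` -/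

include hη ha in
/-- **THE KERNEL OF `T(1) = D_1(1 − R(1))`**: `(T(1)f)(b) = Σ_x (Σ_{y,y′} A(b,y)·c(y,y′)·B(y′,x))•f(x)` with `A` = the `D_1G′(1)Q̃′†`-kernel, `c` = the `(Q̃′G′(1)²Q̃′†)⁻¹`-kernel,
`B` = the `Q̃′G′(1)`-kernel of the prequels ((3.25): `(1 − R(1))f = G′Q̃′†((Q̃′G′²Q̃′†)⁻¹(Q̃′G′f))`). [cite: Balaban1985BackgroundPropagators, (3.25) p.394, (3.3) p.390;
Balaban1984PropagatorsI, (1.44) p.25] -/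
theorem equiv_flatT_apply (f : SiteL2K ℂ (d + 1) (fineP L m) c₀ W) (b : Bond (d + 1) (fineP L m)) :
    WL2.equiv ℂ (fun _ : Bond (d + 1) (fineP L m) => c₀) W
        ((LinearMap.toContinuousLinearMap
        (covDerivL2K ℂ c₀ ((η : ℂ))⁻¹ (adTransportW φ (fun _ : Bond (d + 1) (fineP L m) => (1 : 𝔸ˣ))) ∘ₗ
          (LinearMap.id - RofU L m φ η (fun _ : Bond (d + 1) (fineP L m) => (1 : 𝔸ˣ)) (c₀ := c₀)))) f) b =
      ∑ x : TSite (d + 1) (fineP L m), (∑ y : TSite (d + 1) m, ∑ y' : TSite (d + 1) m,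
        (((η : ℂ))⁻¹ * (((((η * L) ^ 2 * (c₁ / (c₀ * (L : ℝ) ^ (d + 1)))) : ℝ) : ℂ) * KT L (a' * (η * L) ^ 2 * (c₁ / (c₀ * (L : ℝ) ^ (d + 1)))) 0 m (liftSite (btgt b)) (liftSite y) -
            ((((η * L) ^ 2 * (c₁ / (c₀ * (L : ℝ) ^ (d + 1)))) : ℝ) : ℂ) * KT L (a' * (η * L) ^ 2 * (c₁ / (c₀ * (L : ℝ) ^ (d + 1)))) 0 m (liftSite (bpos b)) (liftSite y))) *
        ((((c₀ / c₁ * ((η * L) ^ 2 * (c₁ / (c₀ * (L : ℝ) ^ (d + 1)))) ^ 2 * (L : ℝ) ^ (d + 1))⁻¹ : ℝ) : ℂ) * torusKernel145M L (a' * (η * L) ^ 2 * (c₁ / (c₀ * (L : ℝ) ^ (d + 1)))) m (liftSite y - liftSite y')) *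
        (((c₀ / c₁ * ((η * L) ^ 2 * (c₁ / (c₀ * (L : ℝ) ^ (d + 1)))) : ℝ) : ℂ) * conj (KT L (a' * (η * L) ^ 2 * (c₁ / (c₀ * (L : ℝ) ^ (d + 1)))) 0 m (liftSite x) (liftSite y')))) • WL2.equiv ℂ (fun _ : TSite (d + 1) (fineP L m) => c₀) W f x := by
  have hpos1 := laplacePrimeA_one_pos L m φ η a' hη ha (c₀ := c₀) (c₁ := c₁)
  have hX := QGGQ_pos_one L m φ c₀ η c₁ a' hη ha
  -- `(1 − R(1))f = G′Q̃′†(c(Q̃′G′f))`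
  have h1 : ((LinearMap.id - RofU L m φ η (fun _ : Bond (d + 1) (fineP L m) => (1 : 𝔸ˣ)) (c₀ := c₀) :
      SiteL2K ℂ (d + 1) (fineP L m) c₀ W →ₗ[ℂ] SiteL2K ℂ (d + 1) (fineP L m) c₀ W) f) =
      GpOfU L m φ η (fun _ : Bond (d + 1) (fineP L m) => (1 : 𝔸ˣ)) a' (c₁ := c₁) (laplacePrimeA_one_pos L m φ η a' hη ha)
        (LinearMap.adjoint ((WL2.linearEquiv ℂ ℂ (fun _ : TSite (d + 1) m => c₁)).symm.toLinearMap ∘ₗ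
          QprimeW L m φ (fun _ : Bond (d + 1) (fineP L m) => (1 : 𝔸ˣ)) (c₀ := c₀))
          (greenK _ hX
            (((WL2.linearEquiv ℂ ℂ (fun _ : TSite (d + 1) m => c₁)).symm.toLinearMap ∘ₗ
          QprimeW L m φ (fun _ : Bond (d + 1) (fineP L m) => (1 : 𝔸ˣ)) (c₀ := c₀))
              (GpOfU L m φ η (fun _ : Bond (d + 1) (fineP L m) => (1 : 𝔸ˣ)) a' (c₁ := c₁) (laplacePrimeA_one_pos L m φ η a' hη ha) f)))) := by
    rw [LinearMap.sub_apply, LinearMap.id_apply, RofU_eq_formula_one L m φ c₀ η c₁ a' hη ha f, sub_sub_cancel]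
  rw [LinearMap.coe_toContinuousLinearMap', LinearMap.comp_apply, h1,
    equiv_D_GpQadj_one_apply L m φ c₀ η c₁ hη ha hpos1 _ b]
  simp only [equiv_greenK_QGGQ_one_apply L m φ c₀ η c₁ hη ha hpos1 hX,
    equiv_QGp_one_apply L m φ c₀ η c₁ hη ha hpos1 f, Finset.smul_sum, smul_smul]
  -- `Σ_y Σ_{y′} Σ_x (A c B)•f x = Σ_x (Σ_y Σ_{y′} A c B)•f x`
  simp only [Finset.sum_smul]
  conv_rhs => rw [Finset.sum_comm (β := W)]
  refine Finset.sum_congr rfl fun y _ => ?_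
  conv_rhs => rw [Finset.sum_comm (β := W)]
  refine Finset.sum_congr rfl fun y' _ => Finset.sum_congr rfl fun x _ => ?_
  rw [← mul_assoc]

/-! ## §2 Row L9's `hτ` at the flat background -/

include hη ha in
/-- **ROW L9's `hτ` FOR `T(1) = D_1(1 − R(1))` AT THE FLAT BACKGROUND** — from the DISPLAYED torus-decay letters of the cell (b04's `hbA` for `K_T` at `(L, a, 0, m)`,
pv17's `hbc` for `torusKernel145M` at `(L, a, m)`, common rate `κ₀ > 0`; their VOLUME-free packages are `exists_flatA_bound` ∕ `exists_flatc_bound`) and any slower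
rate `0 ≤ r < κ₀`: for ALL block families and all `y₀, y₁`, `‖P^B_{y₁} ∘L T(1) ∘L P^S_{y₀}‖ ≤ √(d+1)·L^{d+1}·(K_AK_cK_B·K_{d+1}(κ₀−r)²)·e^{−(r·d_m(y₀,y₁))}` —
the `hτ` hypothesis of `B9Eq349KWAssembly.norm_sum_adad_le_lattice` at dimension `d+1`, with a κ₁-FREE rate. [cite: Balaban1985BackgroundPropagators, (3.49) p.399,
(3.101) p.414; Balaban1984PropagatorsI, (1.126) p.38; Balaban1983RegularityDecay, Lemma 2.4 (2.35) p.582] -/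
theorem flat_block_decay {MA Mc κ₀ r : ℝ} (hκ₀ : 0 < κ₀) (hr0 : 0 ≤ r) (hr : r < κ₀)
    (hbA : ∀ (τ : Fin (d + 1) → Fin L) (v : Fin (d + 1) → ℤ), ‖torusKernel248 L (a' * (η * L) ^ 2 * (c₁ / (c₀ * (L : ℝ) ^ (d + 1)))) 0 τ m v‖ ≤ MA * Real.exp (-(κ₀ * torusSupNorm m v)))
    (hbc : ∀ v : Fin (d + 1) → ℤ, ‖torusKernel145M L (a' * (η * L) ^ 2 * (c₁ / (c₀ * (L : ℝ) ^ (d + 1)))) m v‖ ≤ Mc * Real.exp (-(κ₀ * torusSupNorm m v))) :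
    ∀ (PS : TSite (d + 1) m → SiteL2K ℂ (d + 1) (fineP L m) c₀ W →L[ℂ] SiteL2K ℂ (d + 1) (fineP L m) c₀ W),
      (∀ (y : TSite (d + 1) m) (f : SiteL2K ℂ (d + 1) (fineP L m) c₀ W) (x : TSite (d + 1) (fineP L m)),
        WL2.equiv ℂ (fun _ : TSite (d + 1) (fineP L m) => c₀) W (PS y f) x =
          if blockCoord L m x = y then WL2.equiv ℂ (fun _ : TSite (d + 1) (fineP L m) => c₀) W f x else 0) →
      ∀ (PB : TSite (d + 1) m → BondL2K ℂ (d + 1) (fineP L m) c₀ W →L[ℂ] BondL2K ℂ (d + 1) (fineP L m) c₀ W),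
      (∀ (y : TSite (d + 1) m) (g : BondL2K ℂ (d + 1) (fineP L m) c₀ W) (b : Bond (d + 1) (fineP L m)),
        WL2.equiv ℂ (fun _ : Bond (d + 1) (fineP L m) => c₀) W (PB y g) b =
          if blockCoord L m (bpos b) = y then WL2.equiv ℂ (fun _ : Bond (d + 1) (fineP L m) => c₀) W g b else 0) →
      ∀ y₀ y₁ : TSite (d + 1) m, ‖PB y₁ ∘L (LinearMap.toContinuousLinearMap
        (covDerivL2K ℂ c₀ ((η : ℂ))⁻¹ (adTransportW φ (fun _ : Bond (d + 1) (fineP L m) => (1 : 𝔸ˣ))) ∘ₗ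
          (LinearMap.id - RofU L m φ η (fun _ : Bond (d + 1) (fineP L m) => (1 : 𝔸ˣ)) (c₀ := c₀)))) ∘L PS y₀‖ ≤
        Real.sqrt ((d + 1 : ℕ) : ℝ) * (L : ℝ) ^ (d + 1) *
          ((‖((η : ℂ))⁻¹‖ * ((η * L) ^ 2 * (c₁ / (c₀ * (L : ℝ) ^ (d + 1)))) * MA * (Real.exp κ₀ + 1)) * ((c₀ / c₁ * ((η * L) ^ 2 * (c₁ / (c₀ * (L : ℝ) ^ (d + 1)))) ^ 2 * (L : ℝ) ^ (d + 1))⁻¹ * Mc) * (c₀ / c₁ * ((η * L) ^ 2 * (c₁ / (c₀ * (L : ℝ) ^ (d + 1)))) * MA) *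
            latticeConst (d + 1) (κ₀ - r) ^ 2) * Real.exp (-(r * tdist m y₀ y₁)) := by
  have hc₀ : 0 < c₀ := Fact.out
  have hc₁ : 0 < c₁ := Fact.out
  have hL0 : (0 : ℝ) < L := by exact_mod_cast Nat.pos_of_ne_zero (NeZero.ne L)
  have hm : ∀ i, 1 ≤ m i := one_le_period m
  have hρ : 0 ≤ ((η * L) ^ 2 * (c₁ / (c₀ * (L : ℝ) ^ (d + 1)))) := by positivity
  have hσi : 0 ≤ (c₀ / c₁ * ((η * L) ^ 2 * (c₁ / (c₀ * (L : ℝ) ^ (d + 1)))) ^ 2 * (L : ℝ) ^ (d + 1))⁻¹ := by positivity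
  have hB0 : 0 ≤ c₀ / c₁ * ((η * L) ^ 2 * (c₁ / (c₀ * (L : ℝ) ^ (d + 1)))) := by positivity
  -- the three letters' nonnegativity, read off the bounds at one point
  have hMA : 0 ≤ MA := le_of_mul_le_mul_right (by rw [zero_mul]; exact (norm_nonneg _).trans (hbA (fun _ => 0) 0)) (Real.exp_pos _)
  have hMc : 0 ≤ Mc := le_of_mul_le_mul_right (by rw [zero_mul]; exact (norm_nonneg _).trans (hbc 0)) (Real.exp_pos _)
  exact block_decay_of_conv3_kernel hm (LinearMap.toContinuousLinearMap
        (covDerivL2K ℂ c₀ ((η : ℂ))⁻¹ (adTransportW φ (fun _ : Bond (d + 1) (fineP L m) => (1 : 𝔸ˣ))) ∘ₗ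
          (LinearMap.id - RofU L m φ η (fun _ : Bond (d + 1) (fineP L m) => (1 : 𝔸ˣ)) (c₀ := c₀))))
    _ (equiv_flatT_apply L m φ c₀ η c₁ a' hη ha) (fun _ _ => rfl)
    (KA := (‖((η : ℂ))⁻¹‖ * ((η * L) ^ 2 * (c₁ / (c₀ * (L : ℝ) ^ (d + 1)))) * MA * (Real.exp κ₀ + 1))) (Kc := ((c₀ / c₁ * ((η * L) ^ 2 * (c₁ / (c₀ * (L : ℝ) ^ (d + 1)))) ^ 2 * (L : ℝ) ^ (d + 1))⁻¹ * Mc)) (KB := (c₀ / c₁ * ((η * L) ^ 2 * (c₁ / (c₀ * (L : ℝ) ^ (d + 1)))) * MA))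
    (by positivity) (mul_nonneg hσi hMc) (mul_nonneg hB0 hMA) hr0 hr
    (fun b y => norm_flatA_le L m hκ₀.le hρ η hbA b y)
    (fun y y' => norm_flatc_le L m hκ₀.le hσi hbc y y')
    (fun y' x => norm_flatB_le L m hκ₀.le hB0 hbA y' x)

/-! ## §3 The package: a positive rate and a volume-independent formula for the constant -/

omit [NeZero L] [∀ i, NeZero (m i)] [∀ i, NeZero (fineP L m i)] in
/-- positivity of b04's periodisation constant (private helper). [folklore] -/
private theorem periodConst_nonneg' {κ : ℝ} (hκ : 0 < κ) (n : ℕ) : 0 ≤ periodConst κ n := by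
  unfold periodConst
  refine pow_nonneg (div_nonneg (by positivity) ?_) _
  have hκ' : (0 : ℝ) < κ / (n + 1) := by positivity
  have h1 : Real.exp (-(κ / (n + 1))) < 1 := Real.exp_lt_one_iff.mpr (by linarith)
  linarith

include hη in
/-- **THE PACKAGE — `hτ(U ≡ 1)` WITH A κ₁-FREE RATE, BY NAME ON THE CELLS' TORUS DECAYS**: instantiating `hbA`∕`hbc` of `flat_block_decay` by [B4] (2.35) on the torus
(`B4Torus248Decay.kernel248_torusKernel_decay_torusMetric`) and [B5′] (1.45)'s inverse (`B5Torus145Decay.inverse145_torusKernelM_decay_torusMetric`) at the penalty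
`a = ρ` (the auxiliary `a′ := 1`, `c₁ := c₀` — `R(1)` is `a′`-free): there are `r > 0` — HALF the smaller of the two strip letters over `d+1`, a function of `(d, a)` ONLY — and `C ≥ 0` (the displayed formula of §2, a function of
`d, L, η, c₀` and the cells' `(κ, M)`) such that FOR EVERY VOLUME `N` (quantified INSIDE the `∃`): `‖P^B_{y₁} ∘L T(1) ∘L P^S_{y₀}‖ ≤ C·e^{−(r·d_m(y₀,y₁))}` for all block families and sites.
[cite: Balaban1985BackgroundPropagators, (3.49) p.399; Balaban1984PropagatorsI, (1.126) p.38 («The constant O(1) in (1.126) depends on d only»);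
Balaban1983RegularityDecay, Lemma 2.4 (2.35) p.582] -/
theorem exists_flat_block_decay :
    ∃ r C : ℝ, 0 < r ∧ 0 ≤ C ∧ ∀ (N : Fin (d + 1) → ℕ) [∀ i, NeZero (N i)] [∀ i, NeZero (fineP L N i)],
    ∀ (PS : TSite (d + 1) N → SiteL2K ℂ (d + 1) (fineP L N) c₀ W →L[ℂ] SiteL2K ℂ (d + 1) (fineP L N) c₀ W),
      (∀ (y : TSite (d + 1) N) (f : SiteL2K ℂ (d + 1) (fineP L N) c₀ W) (x : TSite (d + 1) (fineP L N)),
        WL2.equiv ℂ (fun _ : TSite (d + 1) (fineP L N) => c₀) W (PS y f) x =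
          if blockCoord L N x = y then WL2.equiv ℂ (fun _ : TSite (d + 1) (fineP L N) => c₀) W f x else 0) →
      ∀ (PB : TSite (d + 1) N → BondL2K ℂ (d + 1) (fineP L N) c₀ W →L[ℂ] BondL2K ℂ (d + 1) (fineP L N) c₀ W),
      (∀ (y : TSite (d + 1) N) (g : BondL2K ℂ (d + 1) (fineP L N) c₀ W) (b : Bond (d + 1) (fineP L N)),
        WL2.equiv ℂ (fun _ : Bond (d + 1) (fineP L N) => c₀) W (PB y g) b =
          if blockCoord L N (bpos b) = y then WL2.equiv ℂ (fun _ : Bond (d + 1) (fineP L N) => c₀) W g b else 0) →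
      ∀ y₀ y₁ : TSite (d + 1) N, ‖PB y₁ ∘L (LinearMap.toContinuousLinearMap
        (covDerivL2K ℂ c₀ ((η : ℂ))⁻¹ (adTransportW φ (fun _ : Bond (d + 1) (fineP L N) => (1 : 𝔸ˣ))) ∘ₗ
          (LinearMap.id - RofU L N φ η (fun _ : Bond (d + 1) (fineP L N) => (1 : 𝔸ˣ)) (c₀ := c₀)))) ∘L PS y₀‖ ≤
        C * Real.exp (-(r * tdist N y₀ y₁)) := by
  have hc₀ : 0 < c₀ := Fact.out
  have hL0 : (0 : ℝ) < L := by exact_mod_cast Nat.pos_of_ne_zero (NeZero.ne L)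
  have hA : 0 < ((1 : ℝ) * (η * L) ^ 2 * (c₀ / (c₀ * (L : ℝ) ^ (d + 1)))) := by
    have : 0 < (η * L) ^ 2 := by positivity
    positivity
  obtain ⟨κ₁, M₁, hκ₁, hM₁, h₁⟩ := kernel248_torusKernel_decay_torusMetric d ((1 : ℝ) * (η * L) ^ 2 * (c₀ / (c₀ * (L : ℝ) ^ (d + 1)))) ((1 : ℝ) * (η * L) ^ 2 * (c₀ / (c₀ * (L : ℝ) ^ (d + 1)))) 0 hA
  obtain ⟨κ₂, c₂, hκ₂, hc₂, h₂⟩ := inverse145_torusKernelM_decay_torusMetric d ((1 : ℝ) * (η * L) ^ 2 * (c₀ / (c₀ * (L : ℝ) ^ (d + 1)))) ((1 : ℝ) * (η * L) ^ 2 * (c₀ / (c₀ * (L : ℝ) ^ (d + 1)))) hA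
  have hd1 : (0 : ℝ) < (d : ℝ) + 1 := by positivity
  set κ₀ : ℝ := min κ₁ κ₂ / ((d : ℝ) + 1) with hκ₀_def
  have hκ₀ : 0 < κ₀ := div_pos (lt_min hκ₁ hκ₂) hd1
  have hκ₀₁ : κ₀ ≤ κ₁ / ((d : ℝ) + 1) := div_le_div_of_nonneg_right (min_le_left _ _) hd1.le
  have hκ₀₂ : κ₀ ≤ κ₂ / ((d : ℝ) + 1) := div_le_div_of_nonneg_right (min_le_right _ _) hd1.le
  have h3 : 0 ≤ M₁ * periodConst κ₁ d := mul_nonneg hM₁ (periodConst_nonneg' hκ₁ d)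
  have h4 : 0 ≤ c₂⁻¹ * periodConst κ₂ d := mul_nonneg (inv_nonneg.mpr hc₂.le) (periodConst_nonneg' hκ₂ d)
  have h5 : 0 ≤ latticeConst (d + 1) (κ₀ - κ₀ / 2) := latticeConst_nonneg _ (by linarith)
  refine ⟨κ₀ / 2,
    (Real.sqrt ((d + 1 : ℕ) : ℝ) * (L : ℝ) ^ (d + 1) *
      ((‖((η : ℂ))⁻¹‖ * ((η * L) ^ 2 * (c₀ / (c₀ * (L : ℝ) ^ (d + 1)))) * (M₁ * periodConst κ₁ d) * (Real.exp κ₀ + 1)) * ((c₀ / c₀ * ((η * L) ^ 2 * (c₀ / (c₀ * (L : ℝ) ^ (d + 1)))) ^ 2 * (L : ℝ) ^ (d + 1))⁻¹ * (c₂⁻¹ * periodConst κ₂ d)) *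
        (c₀ / c₀ * ((η * L) ^ 2 * (c₀ / (c₀ * (L : ℝ) ^ (d + 1)))) * (M₁ * periodConst κ₁ d)) * latticeConst (d + 1) (κ₀ - κ₀ / 2) ^ 2)),
    half_pos hκ₀, by positivity, fun N _ _ => ?_⟩
  · have hN : ∀ i, 1 ≤ N i := one_le_period N
    -- the two displayed letters at the common rate `κ₀`, at the volume `N`
    have hbA : ∀ (τ : Fin (d + 1) → Fin L) (v : Fin (d + 1) → ℤ),
        ‖torusKernel248 L ((1 : ℝ) * (η * L) ^ 2 * (c₀ / (c₀ * (L : ℝ) ^ (d + 1)))) 0 τ N v‖ ≤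
          M₁ * periodConst κ₁ d * Real.exp (-(κ₀ * torusSupNorm N v)) := by
      intro τ v
      refine (h₁ L _ 0 le_rfl le_rfl le_rfl le_rfl τ N hN v).trans (mul_le_mul_of_nonneg_left (Real.exp_le_exp.mpr ?_) h3)
      have := torusSupNorm_nonneg hN v
      nlinarith
    have hbc : ∀ v : Fin (d + 1) → ℤ, ‖torusKernel145M L ((1 : ℝ) * (η * L) ^ 2 * (c₀ / (c₀ * (L : ℝ) ^ (d + 1)))) N v‖ ≤
        c₂⁻¹ * periodConst κ₂ d * Real.exp (-(κ₀ * torusSupNorm N v)) := by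
      intro v
      refine (h₂ L _ le_rfl le_rfl N hN v).trans (mul_le_mul_of_nonneg_left (Real.exp_le_exp.mpr ?_) h4)
      have := torusSupNorm_nonneg hN v
      nlinarith
    exact flat_block_decay L N φ c₀ η c₀ 1 hη one_pos hκ₀ (half_pos hκ₀).le (half_lt_self hκ₀) hbA hbc

end Literature.MathematicalPhysics.QuantumFieldTheory.Balaban1983to89.B9Eq349FlatDPBlockDecay

end
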